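import Mathlib.RingTheory.Nakayama
import Mathlib.RingTheory.Flat.TorsionFree
import Mathlib.RingTheory.LocalRing.MaximalIdeal.Basic
import Mathlib.RingTheory.Jacobson.Ideal
import Mathlib.RingTheory.Noetherian.Basic
import HarnessLib

/-!
# [OURS · L1 W4.5(b) · EL♮] T-EXACT-SHADOW — the OBSTRUCTION TO EXACT POINT LIFTS at points of maximal embedding dimension
# (kernel anchor of census item (ii) of res-D-pv-037's 2026-08-27T08:12:18Z line; res-L1-w45b-lead-2's TARGET (6), file 6)

Crux `EquisingularLiftNat` = stmt-ResolutionOfSingularities-20038 (route EquisingularLift), line `sections`; helper file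
`--supports … --as helper` by res-D-pv-037. HONEST FRAMING: OURS (cell res-hironaka, slot W4.5(b)); NOT a statement of any
manuscript; NEGATIVE-SIDE DOCUMENTATION (ring level) of a limit of the exact-shadow rung (`horizChainE1_of_exactShadow`, p509671):
it says where the lift hypothesis `(MS)` CANNOT be discharged for point centres. AI-written, weaker than expert review.
No `sorry`; standard axioms.

DICTIONARY. Upstairs stage `X₁` (regular), `z` a closed point of the reduced strict transform `V ⊆ X₁`, `A := 𝒪_{X₁,z}` with maximal
ideal `𝔪`, `I := I_{V,z} ⊆ A` the stalk ideal of `V`, so `𝒪_{V,z} = A/I`; an upstairs centre `C` through `z` with stalk ideal `c ⊆ A`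
has EXACT trace `𝔪_{V,z}` (the CJS point centre `{z}`) iff `c + I = 𝔪`. The point `z` has MAXIMAL EMBEDDING DIMENSION in `V`
(`emb dim_z V = emb dim_z X₁`) iff `I ⊆ 𝔪²`. Since `V` lies in the special fibre, the uniformizer satisfies `ϖ ∈ I`.

* `eq_maximalIdeal_of_sup_eq_of_le_sq` — (Nakayama) in a Noetherian local ring, `I ≤ 𝔪²` and `c ⊔ I = 𝔪` force `c = 𝔪`: the
  only «exact point lift» through a point of maximal embedding dimension is the maximal ideal itself, i.e. `V(C) = {z}` near `z`.
* `not_flat_quotient_of_mem` — if a non-zero-divisor `ϖ` of the base `O` maps into `c` and `A/c ≠ 0`, then `A/c` is NOT flat over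
  `O` (flat modules are torsion-free). With `ϖ ∈ I ⊆ 𝔪 = c`: such a centre is never `O`-flat, so it is not admissible.
* `no_exact_flat_point_lift_of_le_sq` — the two combined: `I ≤ 𝔪²`, `ϖ ∈ I`, `ϖ` a non-zero-divisor of `O`, `c ⊔ I = 𝔪`
  ⟹ `¬ Module.Flat O (A ⧸ c)`.

So census item (ii) is a theorem: at a closed point of the running reduced surface whose embedding dimension equals that of
the (regular) ambient — possible only at BAD points, where the special fibre of the ambient is itself singular — NO admissible
centre has exact trace `𝔪_{V,z}`; the CJS point step there is not exactly shadowable (a non-exact device or another order is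
needed). At points with `emb dim_z V ≤ n = dim X₁,k` exact point lifts exist (sections at good points; lead-2's ramified
multisections T-MULTISEC at bad points of surface embedding dimension `n`). References: …NatExactShadow.lean (p509671),
…NatExactShadowCJS.lean (p512696); LEAD-MEMO-2 §7; Mathlib `Submodule.le_of_le_smul_of_le_jacobson_bot` (Stacks 00DV),
`Module.Flat.isSMulRegular_of_nonZeroDivisors`.
-/

set_option linter.dupNamespace false -- mandated namespace `Summit.<Summit>.<Problem>` of this single-conjunct summit

namespace Summit.ResolutionOfSingularities.ResolutionOfSingularities.Cruxes.EquisingularLiftNat.Sections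

open IsLocalRing

universe u v

/-- **Nakayama: an exact point trace at a point of maximal embedding dimension is the maximal ideal.** In a Noetherian local
ring `A` with maximal ideal `𝔪`, if `I ≤ 𝔪²` and `c ⊔ I = 𝔪` then `c = 𝔪`. [folklore; Stacks 00DV] -/
theorem eq_maximalIdeal_of_sup_eq_of_le_sq {A : Type u} [CommRing A] [IsLocalRing A] [IsNoetherianRing A]
    {I c : Ideal A} (hI : I ≤ (maximalIdeal A) ^ 2) (h : c ⊔ I = maximalIdeal A) : c = maximalIdeal A := by
  apply le_antisymm
  · rw [← h]; exact le_sup_left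
  · -- `𝔪 ≤ c ⊔ 𝔪 • 𝔪`, and `𝔪 ≤ jacobson ⊥`
    have hfg : (maximalIdeal A).FG := IsNoetherian.noetherian _
    have hjac : maximalIdeal A ≤ Ideal.jacobson ⊥ := by
      rw [IsLocalRing.jacobson_eq_maximalIdeal ⊥ bot_ne_top]
    refine Submodule.le_of_le_smul_of_le_jacobson_bot hfg hjac ?_
    calc maximalIdeal A = c ⊔ I := h.symm
      _ ≤ c ⊔ (maximalIdeal A) ^ 2 := sup_le_sup_left hI c
      _ = c ⊔ maximalIdeal A • maximalIdeal A := by rw [pow_two, Ideal.smul_eq_mul]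

/-- **A quotient killing a non-zero-divisor of the base is not flat over the base** (flat modules are torsion-free): if
`ϖ ∈ O` is a non-zero-divisor whose image lies in the ideal `c` of the `O`-algebra `A` and `A/c ≠ 0`, then `A/c` is not a flat
`O`-module. [folklore] -/
theorem not_flat_quotient_of_mem {O : Type u} {A : Type v} [CommRing O] [CommRing A] [Algebra O A] {c : Ideal A}
    [Nontrivial (A ⧸ c)] {ϖ : O} (hϖ : ϖ ∈ nonZeroDivisors O) (hmem : algebraMap O A ϖ ∈ c) :
    ¬ Module.Flat O (A ⧸ c) := by
  intro hflat
  have hreg := Module.Flat.isSMulRegular_of_nonZeroDivisors (M := A ⧸ c) hϖ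
  have h1 : ϖ • (1 : A ⧸ c) = 0 := by
    rw [Algebra.smul_def, mul_one, IsScalarTower.algebraMap_apply O A (A ⧸ c), Ideal.Quotient.algebraMap_eq,
      Ideal.Quotient.eq_zero_iff_mem]
    exact hmem
  have h0 : ϖ • (0 : A ⧸ c) = 0 := smul_zero ϖ
  exact one_ne_zero (hreg (h1.trans h0.symm))

/-- **NO EXACT `O`-FLAT POINT LIFT AT A POINT OF MAXIMAL EMBEDDING DIMENSION** (census item (ii) of the exact-shadow rung, ring
level; see the module docstring for the dictionary): `A` Noetherian local over `O`, `I ≤ 𝔪²` containing the image of a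
non-zero-divisor `ϖ` of `O`, and `c ⊔ I = 𝔪` ⟹ `A/c` is not flat over `O`. [folklore] -/
theorem no_exact_flat_point_lift_of_le_sq {O : Type u} {A : Type v} [CommRing O] [CommRing A] [Algebra O A]
    [IsLocalRing A] [IsNoetherianRing A] {I c : Ideal A} (hI : I ≤ (maximalIdeal A) ^ 2)
    {ϖ : O} (hϖ : ϖ ∈ nonZeroDivisors O) (hϖI : algebraMap O A ϖ ∈ I) (h : c ⊔ I = maximalIdeal A) :
    ¬ Module.Flat O (A ⧸ c) := by
  have hc : c = maximalIdeal A := eq_maximalIdeal_of_sup_eq_of_le_sq hI h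
  haveI : Nontrivial (A ⧸ c) :=
    Ideal.Quotient.nontrivial_iff.mpr (by rw [hc]; exact (maximalIdeal.isMaximal A).ne_top)
  refine not_flat_quotient_of_mem hϖ ?_
  rw [hc, ← h]
  exact Ideal.mem_sup_right hϖI

end Summit.ResolutionOfSingularities.ResolutionOfSingularities.Cruxes.EquisingularLiftNat.Sections
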